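/-
Copyright (c) 2026. All rights reserved.
Released under Apache 2.0 license as described in the file LICENSE.
-/
import Literature.AlgebraicGeometry.Pohlmann1968.MultiquadraticCMFieldPartiallyBentTypesSubfield
import Literature.AlgebraicGeometry.Pohlmann1968.MultiquadraticCMFieldNearBentTypes
import Literature.NumberTheory.ComplexMultiplication.DegenerateCMTypesElementaryAbelianNearBentTypesCensus
import HarnessLib

/-!
# Multiquadratic CM fields of degree `64`: EXACTLY `55 552` imprimitive near-bent CM types (`|Stab(Φ)| = 2`), `896`
# with each of the `62` CM subfields of degree `32` as reflex field — and the count of all near-bent types is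
# `55 552 + #{primitive ones}`

SETTING (tree `MultiquadraticCMFieldNearBentTypes`, `MultiquadraticCMFieldPartiallyBentTypesSubfield`,
`DegenerateCMTypesElementaryAbelianNearBentTypesCensus`).  `K` a multiquadratic CM field (`Gal(K/ℚ)` of exponent `2`),
`φ₀ : K → ℂ` a base embedding, `T_Φ = {s : φ₀ ∘ s⁻¹ ∈ Φ}` the group-level type of a CM type `Φ`, `Stab(Φ)` its
stabiliser (tree `twistStabilizer`, `Gal(K/K*)` for the reflex field `K*`).  `Φ` is NEAR-BENT when every odd
character sum of `T_Φ` is `0` or has square `2·|T_Φ| = [K:ℚ]` (C. Carlet [Carlet2020] §6.2.4: semi-bent; they exist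
iff `[K:ℚ]` is a perfect square, tree); then `|Stab(Φ)| ∈ {1, 2}` (tree `natCard_twistStabilizer_eq_one_or_two`):
`|Stab(Φ)| = 2` — IMPRIMITIVE: `Φ` induced from a bent type of the index-`2` subfield `K*`, `Bᵐ(A) = Dᵐ(A)` and the
Hodge conjecture for every power of every abelian variety of type `(K; Φ)` (tree
`hodgeConjectureFor_pow_of_natCard_twistStabilizer_eq_two`); `|Stab(Φ)| = 1` — PRIMITIVE: `A` simple with an
exceptional Hodge class (tree `isSimple_and_exists_exceptional_of_natCard_twistStabilizer_eq_one`).  THIS FILE counts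
the imprimitive ones in degree `64` (the first degree where primitive near-bent types can exist, tree
`sixtyFour_le_finrank_of_natCard_twistStabilizer_eq_one`):

> **Theorem** (`ncard_nearBent_natCard_twistStabilizer_eq_two_of_finrank_eq_sixtyFour`).  **A multiquadratic CM field
> of degree `64` has EXACTLY `55 552 = 62 · 896` near-bent CM types `Φ` with `|Stab(Φ)| = 2`** (tree, group level:
> `62` involutions `a ∉ {1, ρ}`, each the generator of the stabiliser of `896 = |𝓑₄|` of them).
> **Theorem** (`ncard_nearBent_twistStabilizer_eq_of_finrank_eq_sixtyFour`).  **Each CM subfield `F ⊆ K` of degree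
> `32` is the reflex field (`Stab(Φ) = Gal(K/F)`) of EXACTLY `896` near-bent CM types** — the `896` bent CM types of `F`
> inflated to `K` (tree `ncard_partiallyBent_twistStabilizer_eq_of_finrank_eq_thirtyTwo`, and near-bent with
> `|Stab| = 2` ⟺ partially-bent with `|Stab| = 2`).
> **Theorem** (`ncard_nearBent_eq_add_of_finrank_eq_sixtyFour`, `le_ncard_nearBent_of_finrank_eq_sixtyFour`).  **The
> number of near-bent CM types of `K` is `55 552 + #{Φ near-bent : |Stab(Φ)| = 1}` ≥ `55 552`**; the primitive ones —
> CM types of SIMPLE `32`-dimensional abelian varieties with exceptional Hodge classes — are not counted here.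

HONEST SCOPE.  Transport of the tree's group-level census (`NearBentTypesCensus`) along `Φ ↦ T_Φ` (tree
`ncard_cmType_sep_eq`); the figure `55 552 = 62 · 896` is the tree's arithmetic on N. Tokareva's `|𝓑₄| = 896`
[Tokareva2015BentFunctions] §7.1, not a printed number; the existence of primitive near-bent types in degree `64` is
left open here.  THEOREMS ONLY: no definition, no named fact, no instance, no `sorry`.

## References

* [Carlet2020] C. Carlet, *Boolean Functions for Cryptography and Coding Theory*, CUP (2020), §6.2.4 (semi-bent),
  §6.2.1 Proposition 94 / Definition 62 (partially-bent), §3.1.4 Definition 25 (linear structures).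
* [Tokareva2015BentFunctions] N. Tokareva, *Bent Functions*, Academic Press (2015), §7.1 (`|𝓑₄| = 896`).
* [Shimura1998] G. Shimura, *Abelian Varieties with Complex Multiplication and Modular Functions*, §8.4 Example (1), §32.10.
* [Kubota1965] T. Kubota, *On the field extension by complex multiplication*, Trans. AMS 118 (1965), §2, §4 Lemma 2.
* [Gordon1999HodgeAVSurvey] B. B. Gordon, *A survey of the Hodge conjecture for abelian varieties*, Thm. 6.4, §9.

## Provenance

Lane `lit-hodgefound` (Track 2, Layer A3/A5 field dress), seat `lit-hodgefound-p10` generation 44, row g44-#5;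
neighbours cited by name, nothing restated: `DegenerateCMTypesElementaryAbelianNearBentTypesCensus` (g44-#4:
`card_filter_nearBent_card_stabilizer_eq_two_of_card_eq_sixtyFour`, `card_filter_nearBent_eq_add_of_card_eq_sixtyFour`,
`filter_nearBent_card_stabilizer_eq_two_eq`, USED), `MultiquadraticCMFieldPartiallyBentTypesSubfield` (g44-#3:
`ncard_partiallyBent_twistStabilizer_eq_of_finrank_eq_thirtyTwo`, USED), `DegenerateCMTypesElementaryAbelianNearBentTypesCensus`
(`nearBent_of_partiallyBent_of_card_stabilizer_eq_two`, `partiallyBent_of_nearBent_of_card_stabilizer_eq_two`, USED),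
`AbelianCMFieldStabilizerCharacterCriterion` (`natCard_twistStabilizer_eq_card_stabilizer`,
`mem_twistStabilizer_iff_forall_mul_mem_iff`, USED), `DegenerateCMTypesCyclicCMFieldPrimeSquare` (`ncard_cmType_sep_eq`),
`SimpleDegenerateCMAbelianVarietiesCompositeDimension` (`card_gal_eq_finrank`, `conjGalElt_ne_one`),
`NondegenerateCMTypeExistenceAbelianField` (`apply_conjGal_eq`), `CosetGermGaloisSetting` (`CMNumbers.index_fixingSubgroup_eq_finrank`),
`MultiquadraticCMFieldRankFiveTypesHodgeConjecture` (`Multiquadratic.isAbelianGalois_of_forall_sq_eq_one`).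
-/

open scoped BigOperators NumberField IsMulCommutative Classical
open NumberField Module IntermediateField

namespace Literature.AlgebraicGeometry.Pohlmann1968

namespace MultiquadraticNearBentCensus

open scoped Literature.NumberTheory.ComplexMultiplication
open Literature.NumberTheory.ComplexMultiplication (twistStabilizer IsCMTypeWith conjGal)
open Literature.NumberTheory.ComplexMultiplication.CMNumbers (index_fixingSubgroup_eq_finrank)
open Literature.NumberTheory.ComplexMultiplication.CyclicCMType.ExponentTwo.NearBentTypesCensus
  (card_filter_nearBent_card_stabilizer_eq_two_of_card_eq_sixtyFour card_filter_nearBent_eq_add_of_card_eq_sixtyFour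
   nearBent_of_partiallyBent_of_card_stabilizer_eq_two partiallyBent_of_nearBent_of_card_stabilizer_eq_two)
open Literature.AlgebraicGeometry.Pohlmann1968.MultiquadraticPartiallyBentSubfield
  (ncard_partiallyBent_twistStabilizer_eq_of_finrank_eq_thirtyTwo)
open Literature.AlgebraicGeometry.Motives (CMType)

variable {K : Type} [Field K] [NumberField K] [IsCMField K] [IsGalois ℚ K]

/-! ## §0 Helpers -/

section Helpers

omit [IsGalois ℚ K] in
/-- `φ₀ ∘ ρ = conj ∘ φ₀`. [cite: Shimura1998, §18.2 Lemma (i)] -/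
private theorem apply_conjGal_eq_nc (φ₀ : K →+* ℂ) (x : K) :
    φ₀ ((conjGal : K ≃ₐ[ℚ] K) x) = starRingEnd ℂ (φ₀ x) :=
  AbelianCMFieldExistence.apply_conjGal_eq φ₀ x

/-- Transport of a count of CM types with a condition on `T_Φ` and on `|Stab(Φ)|` to the Galois group
(tree `ncard_cmType_sep_eq`, `natCard_twistStabilizer_eq_card_stabilizer`). [cite: Shimura1998, §8.1 and §8.4 Example (1)] -/
private theorem ncard_eq_card_filter_nc (hexp : ∀ g : K ≃ₐ[ℚ] K, g ^ 2 = 1) (φ₀ : K →+* ℂ)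
    (Q : Finset (K ≃ₐ[ℚ] K) → Prop) (n : ℕ) :
    {Φ : CMType K | Q (Finset.univ.filter fun s : K ≃ₐ[ℚ] K => embOf φ₀ s ∈ Φ.1) ∧
        Nat.card (twistStabilizer Φ) = n}.ncard =
      ((Finset.univ : Finset (Finset (K ≃ₐ[ℚ] K))).filter fun T : Finset (K ≃ₐ[ℚ] K) =>
        IsCMTypeWith (conjGal : K ≃ₐ[ℚ] K) (T : Set (K ≃ₐ[ℚ] K)) ∧ Q T ∧
          (Finset.univ.filter fun g : K ≃ₐ[ℚ] K => ∀ t : K ≃ₐ[ℚ] K, t * g ∈ T ↔ t ∈ T).card = n).card := by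
  haveI := Multiquadratic.isAbelianGalois_of_forall_sq_eq_one hexp
  rw [CyclicPrimeSquare.ncard_cmType_sep_eq (apply_conjGal_eq_nc φ₀) _
    (fun T : Finset (K ≃ₐ[ℚ] K) => Q T ∧
      (Finset.univ.filter fun g : K ≃ₐ[ℚ] K => ∀ t : K ≃ₐ[ℚ] K, t * g ∈ T ↔ t ∈ T).card = n)
    (fun Φ => by rw [natCard_twistStabilizer_eq_card_stabilizer φ₀ Φ])]
  have hset : {ΦG : Finset (K ≃ₐ[ℚ] K) | IsCMTypeWith (conjGal : K ≃ₐ[ℚ] K) (ΦG : Set (K ≃ₐ[ℚ] K)) ∧ Q ΦG ∧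
      (Finset.univ.filter fun g : K ≃ₐ[ℚ] K => ∀ t : K ≃ₐ[ℚ] K, t * g ∈ ΦG ↔ t ∈ ΦG).card = n} =
      ↑((Finset.univ : Finset (Finset (K ≃ₐ[ℚ] K))).filter fun T : Finset (K ≃ₐ[ℚ] K) =>
        IsCMTypeWith (conjGal : K ≃ₐ[ℚ] K) (T : Set (K ≃ₐ[ℚ] K)) ∧ Q T ∧
          (Finset.univ.filter fun g : K ≃ₐ[ℚ] K => ∀ t : K ≃ₐ[ℚ] K, t * g ∈ T ↔ t ∈ T).card = n) := by
    ext T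
    simp only [Set.mem_setOf_eq, Finset.coe_filter, Finset.mem_univ, true_and]
  rw [hset, Set.ncard_coe_finset]

/-- The same without a stabiliser condition. [cite: Shimura1998, §8.1] -/
private theorem ncard_eq_card_filter_nc' (hexp : ∀ g : K ≃ₐ[ℚ] K, g ^ 2 = 1) (φ₀ : K →+* ℂ)
    (Q : Finset (K ≃ₐ[ℚ] K) → Prop) :
    {Φ : CMType K | Q (Finset.univ.filter fun s : K ≃ₐ[ℚ] K => embOf φ₀ s ∈ Φ.1)}.ncard =
      ((Finset.univ : Finset (Finset (K ≃ₐ[ℚ] K))).filter fun T : Finset (K ≃ₐ[ℚ] K) =>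
        IsCMTypeWith (conjGal : K ≃ₐ[ℚ] K) (T : Set (K ≃ₐ[ℚ] K)) ∧ Q T).card := by
  haveI := Multiquadratic.isAbelianGalois_of_forall_sq_eq_one hexp
  rw [CyclicPrimeSquare.ncard_cmType_sep_eq (apply_conjGal_eq_nc φ₀) _ Q (fun Φ => Iff.rfl)]
  have hset : {ΦG : Finset (K ≃ₐ[ℚ] K) | IsCMTypeWith (conjGal : K ≃ₐ[ℚ] K) (ΦG : Set (K ≃ₐ[ℚ] K)) ∧ Q ΦG} =
      ↑((Finset.univ : Finset (Finset (K ≃ₐ[ℚ] K))).filter fun T : Finset (K ≃ₐ[ℚ] K) =>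
        IsCMTypeWith (conjGal : K ≃ₐ[ℚ] K) (T : Set (K ≃ₐ[ℚ] K)) ∧ Q T) := by
    ext T
    simp only [Set.mem_setOf_eq, Finset.coe_filter, Finset.mem_univ, true_and]
  rw [hset, Set.ncard_coe_finset]

end Helpers

/-! ## §1 Degree `64`: the `55 552` imprimitive near-bent CM types -/

section DegreeSixtyFour

/-- **A MULTIQUADRATIC CM FIELD OF DEGREE `64` HAS EXACTLY `55 552 = 62 · 896` NEAR-BENT CM TYPES WITH `|Stab(Φ)| = 2`**
(the imprimitive ones: induced from the `896` bent CM types of each of the `62` CM subfields of degree `32`; their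
abelian varieties satisfy the Hodge conjecture with all powers, tree `hodgeConjectureFor_pow_of_natCard_twistStabilizer_eq_two`).
[cite: Tokareva2015BentFunctions, §7.1] [cite: Carlet2020, §6.2.4] [cite: Shimura1998, §8.4 Example (1)] -/
theorem ncard_nearBent_natCard_twistStabilizer_eq_two_of_finrank_eq_sixtyFour (hexp : ∀ g : K ≃ₐ[ℚ] K, g ^ 2 = 1)
    (φ₀ : K →+* ℂ) (hK : finrank ℚ K = 64) :
    {Φ : CMType K |
      (∀ χ : AddChar (Additive (K ≃ₐ[ℚ] K)) ℂ, χ (Additive.ofMul (conjGal : K ≃ₐ[ℚ] K)) = -1 →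
        ∑ s ∈ (Finset.univ.filter fun s : K ≃ₐ[ℚ] K => embOf φ₀ s ∈ Φ.1), χ (Additive.ofMul s) = 0 ∨
          (∑ s ∈ (Finset.univ.filter fun s : K ≃ₐ[ℚ] K => embOf φ₀ s ∈ Φ.1), χ (Additive.ofMul s)) ^ 2 =
            2 * ((Finset.univ.filter fun s : K ≃ₐ[ℚ] K => embOf φ₀ s ∈ Φ.1).card : ℂ)) ∧
      Nat.card (twistStabilizer Φ) = 2}.ncard = 55552 := by
  haveI := Multiquadratic.isAbelianGalois_of_forall_sq_eq_one hexp
  rw [ncard_eq_card_filter_nc hexp φ₀ (fun T : Finset (K ≃ₐ[ℚ] K) =>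
    ∀ χ : AddChar (Additive (K ≃ₐ[ℚ] K)) ℂ, χ (Additive.ofMul (conjGal : K ≃ₐ[ℚ] K)) = -1 →
      ∑ s ∈ T, χ (Additive.ofMul s) = 0 ∨ (∑ s ∈ T, χ (Additive.ofMul s)) ^ 2 = 2 * (T.card : ℂ)) 2]
  have h64 : Fintype.card (K ≃ₐ[ℚ] K) = 64 := by rw [card_gal_eq_finrank φ₀, hK]
  convert card_filter_nearBent_card_stabilizer_eq_two_of_card_eq_sixtyFour hexp
    (conjGalElt_ne_one (apply_conjGal_eq_nc φ₀)) h64 using 3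

/-- **EACH CM SUBFIELD `F` OF DEGREE `32` OF A DEGREE-`64` MULTIQUADRATIC CM FIELD IS THE REFLEX FIELD OF EXACTLY `896`
NEAR-BENT CM TYPES** (`Stab(Φ) = Gal(K/F)`, of order `2`; near-bent with `|Stab| = 2` ⟺ partially-bent with
`|Stab| = 2`, and the tree's count of the partially-bent types with reflex field `F`).
[cite: Tokareva2015BentFunctions, §7.1] [cite: Shimura1998, §8.4 Example (1)] [cite: Carlet2020, §6.2.4] -/
theorem ncard_nearBent_twistStabilizer_eq_of_finrank_eq_sixtyFour (hexp : ∀ g : K ≃ₐ[ℚ] K, g ^ 2 = 1)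
    (φ₀ : K →+* ℂ) (hK : finrank ℚ K = 64) (F : IntermediateField ℚ K) [Normal ℚ F] (hF : ¬ IsTotallyReal F)
    (hdeg : finrank ℚ F = 32) :
    {Φ : CMType K |
      (∀ χ : AddChar (Additive (K ≃ₐ[ℚ] K)) ℂ, χ (Additive.ofMul (conjGal : K ≃ₐ[ℚ] K)) = -1 →
        ∑ s ∈ (Finset.univ.filter fun s : K ≃ₐ[ℚ] K => embOf φ₀ s ∈ Φ.1), χ (Additive.ofMul s) = 0 ∨
          (∑ s ∈ (Finset.univ.filter fun s : K ≃ₐ[ℚ] K => embOf φ₀ s ∈ Φ.1), χ (Additive.ofMul s)) ^ 2 =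
            2 * ((Finset.univ.filter fun s : K ≃ₐ[ℚ] K => embOf φ₀ s ∈ Φ.1).card : ℂ)) ∧
      twistStabilizer Φ = F.fixingSubgroup}.ncard = 896 := by
  haveI := Multiquadratic.isAbelianGalois_of_forall_sq_eq_one hexp
  rw [← ncard_partiallyBent_twistStabilizer_eq_of_finrank_eq_thirtyTwo hexp φ₀ F hF hdeg]
  -- `|Gal(K/F)| = 2`
  have hidx : Nat.card F.fixingSubgroup = 2 := by
    have h1 := F.fixingSubgroup.card_mul_index
    have hG : Nat.card (K ≃ₐ[ℚ] K) = 64 := by rw [Nat.card_eq_fintype_card, card_gal_eq_finrank φ₀, hK]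
    rw [index_fixingSubgroup_eq_finrank F, hdeg, hG] at h1
    omega
  congr 1
  ext Φ
  simp only [Set.mem_setOf_eq]
  constructor
  · rintro ⟨hnb, hstab⟩
    have h2 : (Finset.univ.filter fun g : K ≃ₐ[ℚ] K => ∀ t : K ≃ₐ[ℚ] K,
        t * g ∈ (Finset.univ.filter fun s : K ≃ₐ[ℚ] K => embOf φ₀ s ∈ Φ.1) ↔
          t ∈ (Finset.univ.filter fun s : K ≃ₐ[ℚ] K => embOf φ₀ s ∈ Φ.1)).card = 2 := by
      rw [← natCard_twistStabilizer_eq_card_stabilizer φ₀ Φ, hstab, hidx]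
    exact ⟨partiallyBent_of_nearBent_of_card_stabilizer_eq_two hexp
      (CyclicTwoOddPrimes.isCMTypeWith_galType (apply_conjGal_eq_nc φ₀) Φ) hnb h2, hstab⟩
  · rintro ⟨hpb, hstab⟩
    have h2 : (Finset.univ.filter fun g : K ≃ₐ[ℚ] K => ∀ t : K ≃ₐ[ℚ] K,
        t * g ∈ (Finset.univ.filter fun s : K ≃ₐ[ℚ] K => embOf φ₀ s ∈ Φ.1) ↔
          t ∈ (Finset.univ.filter fun s : K ≃ₐ[ℚ] K => embOf φ₀ s ∈ Φ.1)).card = 2 := by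
      rw [← natCard_twistStabilizer_eq_card_stabilizer φ₀ Φ, hstab, hidx]
    exact ⟨nearBent_of_partiallyBent_of_card_stabilizer_eq_two hexp
      (CyclicTwoOddPrimes.isCMTypeWith_galType (apply_conjGal_eq_nc φ₀) Φ) hpb h2, hstab⟩

/-- **THE NUMBER OF NEAR-BENT CM TYPES OF A DEGREE-`64` MULTIQUADRATIC CM FIELD IS `55 552 + #{Φ near-bent : |Stab(Φ)| = 1}`**
(every near-bent type has `|Stab(Φ)| ∈ {1, 2}`; the primitive ones give SIMPLE `32`-dimensional CM abelian varieties
with exceptional Hodge classes, tree `isSimple_and_exists_exceptional_of_natCard_twistStabilizer_eq_one`; they are not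
counted here). [cite: Carlet2020, §6.2.4] [cite: Shimura1998, §32.10] [cite: Tokareva2015BentFunctions, §7.1] -/
theorem ncard_nearBent_eq_add_of_finrank_eq_sixtyFour (hexp : ∀ g : K ≃ₐ[ℚ] K, g ^ 2 = 1) (φ₀ : K →+* ℂ)
    (hK : finrank ℚ K = 64) :
    {Φ : CMType K |
      ∀ χ : AddChar (Additive (K ≃ₐ[ℚ] K)) ℂ, χ (Additive.ofMul (conjGal : K ≃ₐ[ℚ] K)) = -1 →
        ∑ s ∈ (Finset.univ.filter fun s : K ≃ₐ[ℚ] K => embOf φ₀ s ∈ Φ.1), χ (Additive.ofMul s) = 0 ∨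
          (∑ s ∈ (Finset.univ.filter fun s : K ≃ₐ[ℚ] K => embOf φ₀ s ∈ Φ.1), χ (Additive.ofMul s)) ^ 2 =
            2 * ((Finset.univ.filter fun s : K ≃ₐ[ℚ] K => embOf φ₀ s ∈ Φ.1).card : ℂ)}.ncard =
      55552 + {Φ : CMType K |
        (∀ χ : AddChar (Additive (K ≃ₐ[ℚ] K)) ℂ, χ (Additive.ofMul (conjGal : K ≃ₐ[ℚ] K)) = -1 →
          ∑ s ∈ (Finset.univ.filter fun s : K ≃ₐ[ℚ] K => embOf φ₀ s ∈ Φ.1), χ (Additive.ofMul s) = 0 ∨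
            (∑ s ∈ (Finset.univ.filter fun s : K ≃ₐ[ℚ] K => embOf φ₀ s ∈ Φ.1), χ (Additive.ofMul s)) ^ 2 =
              2 * ((Finset.univ.filter fun s : K ≃ₐ[ℚ] K => embOf φ₀ s ∈ Φ.1).card : ℂ)) ∧
        Nat.card (twistStabilizer Φ) = 1}.ncard := by
  haveI := Multiquadratic.isAbelianGalois_of_forall_sq_eq_one hexp
  rw [ncard_eq_card_filter_nc' hexp φ₀ (fun T : Finset (K ≃ₐ[ℚ] K) =>
    ∀ χ : AddChar (Additive (K ≃ₐ[ℚ] K)) ℂ, χ (Additive.ofMul (conjGal : K ≃ₐ[ℚ] K)) = -1 →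
      ∑ s ∈ T, χ (Additive.ofMul s) = 0 ∨ (∑ s ∈ T, χ (Additive.ofMul s)) ^ 2 = 2 * (T.card : ℂ)),
    ncard_eq_card_filter_nc hexp φ₀ (fun T : Finset (K ≃ₐ[ℚ] K) =>
    ∀ χ : AddChar (Additive (K ≃ₐ[ℚ] K)) ℂ, χ (Additive.ofMul (conjGal : K ≃ₐ[ℚ] K)) = -1 →
      ∑ s ∈ T, χ (Additive.ofMul s) = 0 ∨ (∑ s ∈ T, χ (Additive.ofMul s)) ^ 2 = 2 * (T.card : ℂ)) 1]
  have h64 : Fintype.card (K ≃ₐ[ℚ] K) = 64 := by rw [card_gal_eq_finrank φ₀, hK]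
  convert card_filter_nearBent_eq_add_of_card_eq_sixtyFour hexp (conjGalElt_ne_one (apply_conjGal_eq_nc φ₀)) h64
    using 4

/-- **AT LEAST `55 552` NEAR-BENT CM TYPES** on a multiquadratic CM field of degree `64`. [cite: Tokareva2015BentFunctions, §7.1]
[cite: Carlet2020, §6.2.4] -/
theorem le_ncard_nearBent_of_finrank_eq_sixtyFour (hexp : ∀ g : K ≃ₐ[ℚ] K, g ^ 2 = 1) (φ₀ : K →+* ℂ)
    (hK : finrank ℚ K = 64) :
    55552 ≤ {Φ : CMType K |
      ∀ χ : AddChar (Additive (K ≃ₐ[ℚ] K)) ℂ, χ (Additive.ofMul (conjGal : K ≃ₐ[ℚ] K)) = -1 →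
        ∑ s ∈ (Finset.univ.filter fun s : K ≃ₐ[ℚ] K => embOf φ₀ s ∈ Φ.1), χ (Additive.ofMul s) = 0 ∨
          (∑ s ∈ (Finset.univ.filter fun s : K ≃ₐ[ℚ] K => embOf φ₀ s ∈ Φ.1), χ (Additive.ofMul s)) ^ 2 =
            2 * ((Finset.univ.filter fun s : K ≃ₐ[ℚ] K => embOf φ₀ s ∈ Φ.1).card : ℂ)}.ncard := by
  rw [ncard_nearBent_eq_add_of_finrank_eq_sixtyFour hexp φ₀ hK]
  exact Nat.le_add_right _ _

end DegreeSixtyFour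

end MultiquadraticNearBentCensus

end Literature.AlgebraicGeometry.Pohlmann1968
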